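import Literature.NumberTheory.Automorphic.RestrictedTensorProduct
import HarnessLib

/-!
# Discharged fact: a restricted tensor product of smooth representations is smooth

Topic `NumberTheory/Automorphic`; proof file (smoothness) for
`Literature/NumberTheory/Automorphic/RestrictedTensorProduct.lean`, kept separate from the
sibling `RestrictedTensorProductProofs.lean` (uniqueness / independence of the base vectors).

`Literature.NumberTheory.Automorphic.RestrictedTensorProduct` records as a named fact
(`Literature.Automorphic.IsRestrictedTensorProductRep.isSmooth : Prop`, cited there to Flath 1979, §2,
Example 2) that a restricted tensor product `(W, π, j)` of smooth representations `ρ i` of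
topological groups `G i`, taken with respect to open subgroups `K i ≤ G i` and eventually
`K i`-fixed base vectors `x₀ i`, is a smooth representation of the restricted product group
`Πʳ i, [G i, K i]` (Mathlib `RestrictedProduct`, with its Mathlib topology). This file proves it
(`Literature.NumberTheory.Automorphic.IsRestrictedTensorProductRep.isSmooth_holds`), so that users of the fact
`(h : IsRestrictedTensorProductRep.isSmooth)` can be fed `isSmooth_holds`.

## Proof (Flath 1979, §2, Example 2; cf. Bump 1997, §3.4, pp. 293–294, and §4.2, p. 423)

1. `Literature.NumberTheory.Automorphic.isOpen_setOf_forall_mem_restrictedProduct` (general topology): in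
   `Πʳ i, [R i, A i]` the set `{f | ∀ i, f i ∈ B i}` is open whenever every `B i` is open and
   `A i ⊆ B i` for all but finitely many `i`. Indeed the topology is the inductive limit of the
   charts `Πʳ i, [R i, A i]_[𝓟 S]`, `S` cofinite, each carrying the topology induced from
   `Π i, R i` (Mathlib `RestrictedProduct.topologicalSpace_eq_iSup`), and on such a chart the set
   is the preimage of the finite-type box `∏_{i ∉ S ∩ {A ⊆ B}} B i`. (This is the pattern of
   Mathlib's `RestrictedProduct.isOpen_forall_mem`, the case `B = A`.)
2. `IsRestrictedTensorProductRep.isSmoothVector_apply`: a pure tensor `j x` is a smooth vector.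
   Its stabiliser contains, by equivariance `j (g • x) = π g (j x)`, the subgroup
   `H = {g | ∀ i, ρ i (g i) (x i) = x i}`; every `Stab(x i)` is open (smoothness of `ρ i`) and
   contains `K i` whenever `x i = x₀ i` is `K i`-fixed, i.e. for all but finitely many `i`, so
   `H` is open by step 1, and a subgroup containing an open subgroup is open
   (this uses that `Πʳ i, [G i, K i]` is a topological group, Mathlib
   `RestrictedProduct.isTopologicalGroup`, available once the `K i` are open).
3. `IsRestrictedTensorProductRep.isSmooth_holds`: the ranges of the maps
   `liftFinset S : ⨂[k] i : S, V i → W` exhaust `W` and each finite tensor product is spanned by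
   its pure tensors (Mathlib `PiTensorProduct.induction_on`), whose images are the `j x`; smooth
   vectors are stable under sums and scalar multiples.

## References

* D. Flath, *Decomposition of representations into tensor products*, in: Automorphic forms,
  representations and `L`-functions (Corvallis 1977), Proc. Sympos. Pure Math. 33, part 1,
  Amer. Math. Soc. (1979), 179–183, §2, Example 2. [Flath1979]
* D. Bump, *Automorphic forms and representations*, Cambridge Studies in Advanced Mathematics 55
  (1997), §3.3–3.4 (pp. 293–294: restricted tensor products and the representation of the
  restricted direct product on them), §4.2 (p. 423: smooth representations). [Bump1997]
-/

open scoped RestrictedProduct TensorProduct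
open Filter PiTensorProduct

namespace Literature.NumberTheory.Automorphic

section SmoothProof

/-- In a restricted product `Πʳ i, [R i, A i]` (cofinite filter, Mathlib's topology) the set of
families `f` with `f i ∈ B i` for *every* `i` is open as soon as each `B i` is open and
`A i ⊆ B i` for all but finitely many `i`: on each chart `Πʳ i, [R i, A i]_[𝓟 S]`, `S` cofinite,
it is cut out by the finitely many open conditions at the indices outside
`S ∩ {i | A i ⊆ B i}`. This generalises Mathlib's `RestrictedProduct.isOpen_forall_mem` (the
case `B = A`). [folklore] -/
theorem isOpen_setOf_forall_mem_restrictedProduct {ι : Type*} {R : ι → Type*}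
    [∀ i, TopologicalSpace (R i)] {A B : ∀ i, Set (R i)} (hB : ∀ i, IsOpen (B i))
    (hAB : ∀ᶠ i in cofinite, A i ⊆ B i) :
    IsOpen {f : Πʳ i, [R i, A i] | ∀ i, f i ∈ B i} := by
  have key : ∀ (S : Set ι), cofinite ≤ 𝓟 S →
      IsOpen {f : Πʳ i, [R i, A i]_[𝓟 S] | ∀ i, f i ∈ B i} := by
    intro S hS
    rw [Filter.le_principal_iff] at hS
    have hfin : (S ∩ {i | A i ⊆ B i})ᶜ.Finite :=
      Filter.mem_cofinite.mp (Filter.inter_mem hS hAB)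
    have hset : {f : Πʳ i, [R i, A i]_[𝓟 S] | ∀ i, f i ∈ B i} =
        ((↑) : Πʳ i, [R i, A i]_[𝓟 S] → Π i, R i) ⁻¹' (S ∩ {i | A i ⊆ B i})ᶜ.pi B := by
      ext f
      refine ⟨fun H i _ => H i, fun H i => ?_⟩
      by_cases hi : i ∈ S ∩ {i | A i ⊆ B i}
      · exact hi.2 (Filter.eventually_principal.mp f.eventually i hi.1)
      · exact H i hi
    rw [hset]
    exact (isOpen_set_pi hfin fun i _ => hB i).preimage RestrictedProduct.continuous_coe
  simp_rw +instances [RestrictedProduct.topologicalSpace_eq_iSup cofinite, isOpen_iSup_iff,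
    isOpen_coinduced]
  exact fun S hS => key S hS

variable {ι : Type*} {k : Type*} [CommRing k] {G : ι → Type*} [∀ i, Group (G i)]
  {K : ∀ i, Subgroup (G i)} {V : ι → Type*} [∀ i, AddCommGroup (V i)] [∀ i, Module k (V i)]
  {ρ : ∀ i, Representation k (G i) (V i)} {x₀ : ∀ i, V i} [DecidableEq ι]
  {W : Type*} [AddCommGroup W] [Module k W] {π : Representation k (Πʳ i, [G i, K i]) W}
  {hx₀ : ∀ᶠ i in cofinite, x₀ i ∈ (ρ i).fixedPoints (K i)}
  {j : RestrictedFamily V x₀ → W} {S₀ : Finset ι}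
  [∀ i, TopologicalSpace (G i)] [∀ i, IsTopologicalGroup (G i)]

/-- The pure tensors of a restricted tensor product of smooth representations (with respect to
open subgroups `K i`) are smooth vectors: the stabiliser of `j x` in `Πʳ i, [G i, K i]` contains,
by equivariance, the subgroup `{g | ∀ i, ρ i (g i) (x i) = x i}`, which is open because every
`Stab(x i)` is open and contains `K i` for all but finitely many `i`.
(Flath 1979, §2, Example 2; Bump 1997, §3.4.) [cite: Flath1979, §2 Example 2] -/
theorem IsRestrictedTensorProductRep.isSmoothVector_apply (hK : ∀ i, IsOpen (K i : Set (G i)))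
    (hρ : ∀ i, (ρ i).IsSmooth) (h : IsRestrictedTensorProductRep ρ π hx₀ j S₀)
    (x : RestrictedFamily V x₀) : π.IsSmoothVector (j x) := by
  haveI : Fact (∀ i, IsOpen (K i : Set (G i))) := ⟨hK⟩
  -- The subgroup of elements fixing every coordinate of `x`.
  obtain ⟨H, hmem⟩ : ∃ H : Subgroup (Πʳ i, [G i, K i]),
      ∀ g : Πʳ i, [G i, K i], g ∈ H ↔ ∀ i, ρ i (g i) (x i) = x i :=
    ⟨⨅ i, ((ρ i).stabilizerSubgroup (x i)).comap (RestrictedProduct.evalMonoidHom G i),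
      fun g => by
        simp only [Subgroup.mem_iInf, Subgroup.mem_comap, RestrictedProduct.evalMonoidHom_apply,
          Representation.mem_stabilizerSubgroup]⟩
  have hB : ∀ i, IsOpen (((ρ i).stabilizerSubgroup (x i) : Subgroup (G i)) : Set (G i)) :=
    fun i => hρ i (x i)
  have hopen : IsOpen (H : Set (Πʳ i, [G i, K i])) := by
    have hH : (H : Set (Πʳ i, [G i, K i])) =
        {g | ∀ i, g i ∈ ((ρ i).stabilizerSubgroup (x i) : Set (G i))} := by
      ext g
      simp only [SetLike.mem_coe, hmem, Set.mem_setOf_eq, Representation.mem_stabilizerSubgroup]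
    rw [hH]
    refine isOpen_setOf_forall_mem_restrictedProduct hB ?_
    filter_upwards [hx₀, x.eventually_eq] with i h₀ hx
    intro g hg
    show ρ i g (x i) = x i
    rw [hx]
    exact ((ρ i).mem_fixedPoints (K i) (x₀ i)).1 h₀ g hg
  refine π.isSmoothVector_of_le hopen fun g hg => ?_
  have hgx : RestrictedFamily.smul ρ hx₀ g x = x := by
    ext i
    rw [RestrictedFamily.smul_apply]
    exact (hmem g).1 hg i
  rw [Representation.mem_stabilizerSubgroup, ← h.map_smul g x, hgx]

/-- **Proof of `IsRestrictedTensorProductRep.isSmooth`.** A restricted tensor product of smooth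
representations of topological groups `G i` with respect to open subgroups `K i` is a smooth
representation of `Πʳ i, [G i, K i]`: every vector of `W` is a finite sum of scalar multiples
of pure tensors `j x` (the ranges of the `liftFinset S` exhaust `W`, and each `⨂[k] i : S, V i`
is spanned by the `tprod k m`), pure tensors are smooth (`isSmoothVector_apply`), and smooth
vectors are stable under sums and scalar multiples.
(Flath 1979, §2, Example 2; Bump 1997, §3.4.) [cite: Flath1979, §2 Example 2] -/
theorem IsRestrictedTensorProductRep.isSmooth_holds :
    IsRestrictedTensorProductRep.isSmooth (ρ := ρ) (π := π) (hx₀ := hx₀) (j := j) (S₀ := S₀) := by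
  intro hK hρ h w
  haveI : Fact (∀ i, IsOpen (K i : Set (G i))) := ⟨hK⟩
  have hw : w ∈ ⨆ S : Finset ι,
      LinearMap.range (h.isRestrictedTensorProduct.isRestrictedMultilinear.liftFinset S) := by
    rw [h.isRestrictedTensorProduct.iSup_range_liftFinset]
    exact Submodule.mem_top
  induction hw using Submodule.iSup_induction' with
  | mem S w hw =>
    obtain ⟨t, rfl⟩ := LinearMap.mem_range.1 hw
    clear hw
    induction t using PiTensorProduct.induction_on with
    | smul_tprod r m =>
      rw [LinearMap.map_smul, IsRestrictedMultilinear.liftFinset_tprod]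
      exact Representation.IsSmoothVector.smul π r (h.isSmoothVector_apply hK hρ _)
    | add a b ha hb =>
      rw [LinearMap.map_add]
      exact Representation.IsSmoothVector.add π ha hb
  | zero => exact π.isSmoothVector_zero
  | add a b _ _ ha hb => exact Representation.IsSmoothVector.add π ha hb

end SmoothProof

end Literature.NumberTheory.Automorphic
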